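import Mathlib
import Summits.Ventures.PercRepro2.SwOutCrossGenProd

/-!
# The product of two dropped components with a JOINT label: definitions (blind cell PercRepro2,
night-4 g25, 2026-08-28; proofs/NIGHT4-G25.md §1)

The product theorem of `SwOutCrossGenProd` types a product point by `(s, label₁ w₁, label₂ w₂)`
with the PRODUCT of the two label orders.  That is not the order the geometry needs: at a point
with all u-arms blue two dropped vertices of DIFFERENT components, both attached to `u` with red
outside edges, carry the red path `p i – u – p j`, a link the product label does not record.  The
proof of the product theorem, however, compares labels only in three situations — at a frozen
core point of the second component, along the core pairing `c ↔ flip c` at a fixed point of the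
first cube, and along the slab injection `theta₁ × psi₂` — and those comparisons hold for a
JOINT label: `JointLabel` bundles a label `labelJ w₁ w₂`, its order `BetterJ`, the value `g` of
the joint label at a core point of the second component through the first label alone
(`labelJ_core`, monotone: `g_mono`), and the three comparisons (`pairJ`, `ncJ`, together with
`thetaJ` for the iterated injection).  This file: the structure, the joint type, its up-sets and
slices, the set `QPJ`, and the product `FibreIter.prodL` with the joint label; the product label
is the instance `JointLabel.prod`.  The inequality is `SwOutCrossGenJointThm`.
-/

namespace Summit.Ventures.PercRepro2

namespace CrossArm

section JointDefs

variable {W₁ A₁ L₁ W₂ A₂ L₂ : Type*}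

/-- **A joint label for the product of a fibre and a component**: the label of a product point,
its order, its value at a core point of the second component through the first label (`g`), and
the three comparisons the product proof makes. -/
structure JointLabel (F₁ : FibreIter W₁ A₁ L₁) (F₂ : FibreDataBit W₂ A₂ L₂) (LJ : Type*) where
  /-- the joint label of a product point -/
  labelJ : W₁ → W₂ → LJ
  /-- `BetterJ l' l`: `l'` is at least as good a joint label as `l` -/
  BetterJ : LJ → LJ → Prop
  /-- `BetterJ` is reflexive -/
  betterJ_refl : ∀ l, BetterJ l l
  /-- the joint label at a core point of the second component, through the first label -/
  g : L₁ → W₂ → LJ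
  /-- at a core point of the second component the joint label is `g` of the first label -/
  labelJ_core : ∀ w₁ c, F₂.core c = true → labelJ w₁ c = g (F₁.label w₁) c
  /-- `g` is monotone in the first label -/
  g_mono : ∀ l l' c, F₂.core c = true → F₁.BetterL l' l → BetterJ (g l' c) (g l c)
  /-- the core pairing: a lower core point of the second component gives the better joint
  label, at every point of the first fibre -/
  pairJ : ∀ w₁, ∀ c ∈ F₂.core0, BetterJ (labelJ w₁ c) (labelJ w₁ (F₂.flip c))
  /-- the slab injection `theta₁ × psi₂` improves the joint label -/
  ncJ : ∀ w₁ w₂, F₁.leakR w₁ = false → F₂.leakR w₂ = false → F₂.core w₂ = false →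
    BetterJ (labelJ (F₁.theta w₁) (F₂.psi w₂)) (labelJ w₁ w₂)
  /-- the injection `theta₁ × theta₂` improves the joint label -/
  thetaJ : ∀ w₁ w₂, F₁.leakR w₁ = false → F₂.leakR w₂ = false →
    BetterJ (labelJ (F₁.theta w₁) (F₂.theta w₂)) (labelJ w₁ w₂)

variable (F₁ : FibreIter W₁ A₁ L₁) (F₂ : FibreDataBit W₂ A₂ L₂)

/-- **The product label is a joint label**: `labelJ = (label₁, label₂)` with the product order
(the order of `SwOutCrossGenProd`). -/
def JointLabel.prod : JointLabel F₁ F₂ (L₁ × L₂) where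
  labelJ := fun w₁ w₂ => (F₁.label w₁, F₂.label w₂)
  BetterJ := fun l' l => F₁.BetterL l'.1 l.1 ∧ F₂.BetterL l'.2 l.2
  betterJ_refl := fun _ => ⟨F₁.betterL_refl _, F₂.betterL_refl _⟩
  g := fun l c => (l, F₂.label c)
  labelJ_core := fun _ _ _ => rfl
  g_mono := fun _ _ _ _ h => ⟨h, F₂.betterL_refl _⟩
  pairJ := fun _ c hc => ⟨F₁.betterL_refl _, F₂.pair_label c hc⟩
  ncJ := fun w₁ w₂ h₁ h₂ hc => ⟨(F₁.theta_ok w₁ h₁).2.1, (F₂.psi_ok w₂ h₂ hc).2.2.1⟩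
  thetaJ := fun w₁ w₂ h₁ h₂ => ⟨(F₁.theta_ok w₁ h₁).2.1, (F₂.theta_ok w₂ h₂).2.1⟩

end JointDefs

section JointTypes

variable {W₁ A₁ L₁ W₂ A₂ L₂ : Type*} {F₁ : FibreIter W₁ A₁ L₁} {F₂ : FibreDataBit W₂ A₂ L₂}
  {ι : Type*} {LJ : Type*} (J : JointLabel F₁ F₂ LJ)

/-- The joint type of a product point: the u-arm bits and the joint label. -/
def typPJ (x : PtP W₁ W₂ ι) : TypG LJ ι := (x.1, J.labelJ x.2.1 x.2.2)

/-- `t'` is at least as good a joint type as `t`: no more red u-arms, a better joint label. -/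
def BetterPJ (t' t : TypG LJ ι) : Prop :=
  (∀ j, t.1 j = false → t'.1 j = false) ∧ J.BetterJ t'.2 t.2

/-- An up-set of joint types. -/
def IsUpPJ (𝒯 : Set (TypG LJ ι)) : Prop := ∀ t ∈ 𝒯, ∀ t', BetterPJ J t' t → t' ∈ 𝒯

/-- The sliced up-set of joint types at a core point `c` of the second component, read through
`g`. -/
def sliceTPJ (𝒯 : Set (TypG LJ ι)) (c : W₂) : Set (TypG L₁ ι) := {t | (t.1, J.g t.2 c) ∈ 𝒯}

/-- The slice of an up-set of joint types at a core point is an up-set of the first cube. -/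
lemma isUpI_sliceTPJ {𝒯 : Set (TypG LJ ι)} (h𝒯 : IsUpPJ J 𝒯) {c : W₂} (hc : F₂.core c = true) :
    IsUpI F₁ (sliceTPJ J 𝒯 c) := by
  intro t ht t' hle
  exact h𝒯 _ ht (t'.1, J.g t'.2 c) ⟨hle.1, J.g_mono _ _ c hc hle.2⟩

variable [Fintype ι] [DecidableEq ι] [Fintype W₁] [DecidableEq W₁] [Fintype W₂] [DecidableEq W₂]

open scoped Classical in
/-- The non-leaking product points whose joint type lies in `𝒯`. -/
noncomputable def QPJ (𝒯 : Set (TypG LJ ι)) : Finset (PtP W₁ W₂ ι) :=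
  Finset.univ.filter fun x => ¬ LeakP F₁ F₂ x ∧ typPJ J x ∈ 𝒯

omit [DecidableEq W₁] [DecidableEq W₂] in
open scoped Classical in
/-- Membership in `QPJ`. -/
lemma mem_QPJ {𝒯 : Set (TypG LJ ι)} {x : PtP W₁ W₂ ι} :
    x ∈ QPJ J 𝒯 ↔ ¬ LeakP F₁ F₂ x ∧ typPJ J x ∈ 𝒯 := by
  simp only [QPJ, Finset.mem_filter, Finset.mem_univ, true_and]

end JointTypes

section ProdL

variable {W₁ A₁ L₁ W₂ A₂ L₂ : Type*} (F₁ : FibreIter W₁ A₁ L₁) (F₂ : FibreDataBit W₂ A₂ L₂)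
  {LJ : Type*} (J : JointLabel F₁ F₂ LJ)

/-- **The product of a fibre and a component as a fibre, with the joint label.** -/
def FibreIter.prodL : FibreIter (W₁ × W₂) (A₁ ⊕ A₂) LJ where
  flip := fun x => (F₁.flip x.1, F₂.flip x.2)
  flip_flip := fun x => by simp [F₁.flip_flip, F₂.flip_flip]
  red := fun x a => match a with
    | Sum.inl a => F₁.red x.1 a
    | Sum.inr a => F₂.red x.2 a
  leakR := fun x => F₁.leakR x.1 || F₂.leakR x.2
  label := fun x => J.labelJ x.1 x.2
  BetterL := J.BetterJ
  betterL_refl := J.betterJ_refl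
  theta := fun x => (F₁.theta x.1, F₂.theta x.2)
  theta_ok := fun x hx => by
    obtain ⟨w₁, w₂⟩ := x
    simp only [Bool.or_eq_false_iff] at hx
    obtain ⟨h1, -, h3⟩ := F₁.theta_ok w₁ hx.1
    obtain ⟨h1', -, h3'⟩ := F₂.theta_ok w₂ hx.2
    refine ⟨by simp [h1, h1'], J.thetaJ w₁ w₂ hx.1 hx.2, fun a ha => ?_⟩
    cases a with
    | inl a => exact h3 a ha
    | inr a => exact h3' a ha
  theta_inj := fun x x' hx hx' h => by
    obtain ⟨w₁, w₂⟩ := x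
    obtain ⟨w₁', w₂'⟩ := x'
    simp only [Bool.or_eq_false_iff] at hx hx'
    simp only [Prod.mk.injEq] at h
    exact Prod.ext (F₁.theta_inj _ _ hx.1 hx'.1 h.1) (F₂.theta_inj _ _ hx.2 hx'.2 h.2)

variable {ι : Type*}

/-- The leak of the joint product fibre is the product leak. -/
lemma LeakI_prodL (x : PtP W₁ W₂ ι) : LeakI (F₁.prodL F₂ J) x ↔ LeakP F₁ F₂ x := by
  obtain ⟨s, w₁, w₂⟩ := x
  simp only [LeakI, LeakP, FibreIter.prodL, Bool.or_eq_true]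
  tauto

/-- The red atoms of the joint product fibre are those of the product fibre. -/
lemma ERI_prodL (x : PtP W₁ W₂ ι) : ERI (F₁.prodL F₂ J) x = ERI (F₁.prod F₂) x := rfl

/-- The red atoms of the joint product fibre are the product red atoms. -/
lemma ERI_prodL_eq (x : PtP W₁ W₂ ι) : ERI (F₁.prodL F₂ J) x = ERP F₁ F₂ x := by
  rw [ERI_prodL, ERI_prod]

/-- The blue atoms of the joint product fibre are the product blue atoms. -/
lemma EBI_prodL (x : PtP W₁ W₂ ι) : EBI (F₁.prodL F₂ J) x = EBP F₁ F₂ x := by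
  show ERI (F₁.prodL F₂ J) (flipI (F₁.prodL F₂ J) x) = ERP F₁ F₂ (flipP F₁ F₂ x)
  rw [ERI_prodL_eq]
  rfl

/-- The type of the joint product fibre is the joint type. -/
lemma typI_prodL (x : PtP W₁ W₂ ι) : typI (F₁.prodL F₂ J) x = typPJ J x := rfl

/-- The up-sets of types of the joint product fibre are the joint up-sets. -/
lemma isUpPJ_of_isUpI {𝒯 : Set (TypG LJ ι)} (h : IsUpI (F₁.prodL F₂ J) 𝒯) : IsUpPJ J 𝒯 :=
  fun t ht t' hle => h t ht t' hle

variable [Fintype ι] [DecidableEq ι] [Fintype W₁] [DecidableEq W₁] [Fintype W₂] [DecidableEq W₂]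

open scoped Classical

omit [DecidableEq W₁] [DecidableEq W₂] in
/-- The non-leaking points of the joint product fibre are `QPJ`. -/
lemma QI_prodL (𝒯 : Set (TypG LJ ι)) : QI (F₁.prodL F₂ J) 𝒯 = QPJ J 𝒯 := by
  ext x
  rw [mem_QI, mem_QPJ, LeakI_prodL]
  rfl

end ProdL

end CrossArm

end Summit.Ventures.PercRepro2
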